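import Summits.BirchSwinnertonDyer.BirchSwinnertonDyer.Theorems.ByReductionTypeAtTwoFineSelmerConjAAtTwoAdditivePotGoodEisensteinDoor
import HarnessLib

/-!
# Route `ByReductionTypeAtTwo` (rung K4), crux C1″ `FineSelmerConjAAtTwoAdditivePotGood` (item stmt-BirchSwinnertonDyer-22615):
# CLASS NUMBER ONE FROM A SMALL CUBIC DISCRIMINANT (KERNEL) — the parity bit `2 ∤ h(ℚ(β))` of the unique-prime door DECIDED
# for every cubic `X³ + pX² + qX + r` with `|disc| ≤ 45`
# (a `--supports 22615` file; seat `bsd-2adic-k4-w1` GEN 4; sequel of `…UniquePrimeDoor` / `…InertDoor` / `…EisensteinDoor`)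

HONEST FRAMING (cell `bsd-2adic`, D-0036/D-0054): types-the-object-of; closes nothing at the `∀`-level; nothing booked; BSD is
not proved by any of this. EVERYTHING HERE IS UNCONDITIONAL KERNEL ARITHMETIC (no named fact).

WHY. After `…UniquePrimeDoor` (Iwasawa 1956 by name, discharged), `…InertDoor` and `…EisensteinDoor` (the splitting of `2` decided
from `(p, q, r) mod 4`), the only displayed datum of the door «`2 ∤ #Cl(𝓞 ℚ(β))` ∧ one prime above `2` ⟹ `μ₂(ℚ(β)) = 0`» is the
class-number parity. This file decides it outright for the SMALLEST cubic fields, by Minkowski: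

* §1 `leftMulMatrix_eq_companion`, **`discr_powers_eq_cubic_discr`**: for ANY `ℚ`-algebra field `L` with a basis `1, θ, θ²` and
  `θ³ + pθ² + qθ + r = 0`, `Algebra.discr ℚ (1, θ, θ²) = disc(X³ + pX² + qX + r)` (`Cubic.discr`) — trace matrix from the companion
  matrix and Newton's identities `Tr θ = −p`, `Tr θ² = p² − 2q`, `Tr θ³ = −p³ + 3pq − 3r`, `Tr θ⁴ = p⁴ − 4p²q + 4pr + 2q²`.
* §2 **`exists_sq_mul_discr_eq`** (the index formula, inequality form): for a CUBIC number field `K` and a root `b ∈ 𝓞 K` of an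
  irreducible monic integer cubic, `disc = m² · d_K` for some integer `m ≠ 0` (`m = det` of the matrix of `1, b, b²` in an integral
  basis); hence `|d_K| ≤ |disc|` (`abs_discr_le_abs_cubic_discr`).
* §3 **`classNumber_eq_one_of_abs_discr_le`**: a cubic number field with `|d_K| ≤ 45` has class number one (Minkowski bound
  `(2 (π/4)^{r₂} 3³/3!)² ≥ (9π/4)² > 45` for `r₂ ≤ 1`; Mathlib's `isPrincipalIdealRing_of_abs_discr_lt`); with §2,
  **`classNumber_eq_one_of_cubic_root`**: irreducible cubic with `|disc| ≤ 45` and a root in `𝓞 K` ⟹ `h_K = 1`.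
* §4 cubic currency: `finrank_adjoin_eq_three_of_irreducible`, **`card_classGroup_adjoin_eq_one_of_abs_discr_le`** (`ℚ(β)` for any
  root `β ∈ ℚ̄`: `#Cl(𝓞 ℚ(β)) = 1`) and `not_two_dvd_card_classGroup_adjoin_of_abs_discr_le`.

Scope: `|disc| ≤ 45` covers the three smallest `S₃`-cubic fields `d = −23` (`X³ − X − 1`), `−31` (`X³ + X − 1`), `−44`
(`X³ − 4X² + 6X − 2`) — see the sequel `…ClassNumberOneDoor` for the UNCONDITIONAL `μ₂ = 0` theorems they yield.

References: [Marcus1977] Ch. 2 (discriminant of a power basis; index formula), Ch. 5 Cor. 2 of Thm. 37 (Minkowski bound);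
[Cohen1993] §4.4, §6.4 and App. B Table B.4; [Neukirch1999] I.(2.9), III.(2.14).
-/

set_option autoImplicit false
-- sibling precedent (`…EisensteinDoor.lean`): the directory name repeats the summit name
set_option linter.dupNamespace false

noncomputable section

open scoped Classical IntermediateField NumberField Real

namespace Summit.BirchSwinnertonDyer.BirchSwinnertonDyer.Theorems.AddKatoTwo

open Polynomial Matrix NumberField IsDedekindDomain

/-! ## §1 The discriminant of `1, θ, θ²` is the discriminant of the cubic -/

section PowerBasisDiscr

variable {L : Type*} [Field L] [Algebra ℚ L]

/-- **Multiplication by `θ` in the basis `1, θ, θ²` is the companion matrix** of `X³ + pX² + qX + r` (columns `θ·1 = θ`,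
`θ·θ = θ²`, `θ·θ² = −r − qθ − pθ²`). [folklore] -/
theorem leftMulMatrix_eq_companion {p q r : ℚ} (θ : L) (b3 : Module.Basis (Fin 3) ℚ L)
    (hb : ∀ i, b3 i = θ ^ (i : ℕ)) (hθ : θ ^ 3 + p * θ ^ 2 + q * θ + r = 0) :
    Algebra.leftMulMatrix b3 θ = !![0, 0, -r; 1, 0, -q; 0, 1, -p] := by
  have h0 : θ * b3 0 = b3 1 := by rw [hb, hb]; simp
  have h1 : θ * b3 1 = b3 2 := by rw [hb, hb]; simp [pow_succ]
  have h2 : θ * b3 2 = (-r) • b3 0 + (-q) • b3 1 + (-p) • b3 2 := by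
    rw [hb, hb, hb]
    simp only [Fin.val_zero, Fin.val_one, Fin.val_two, pow_zero, pow_one, Algebra.smul_def, eq_ratCast]
    push_cast
    linear_combination hθ
  ext i j
  rw [Algebra.leftMulMatrix_eq_repr_mul]
  fin_cases j
  · simp only [Fin.zero_eta, Fin.isValue, h0, Module.Basis.repr_self]
    fin_cases i <;> simp
  · simp only [Fin.mk_one, Fin.isValue, h1, Module.Basis.repr_self]
    fin_cases i <;> simp
  · simp only [Fin.reduceFinMk, Fin.isValue, h2, map_add, map_smul, Module.Basis.repr_self]
    fin_cases i <;> simp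

/-- **`Algebra.discr ℚ (1, θ, θ²) = disc(X³ + pX² + qX + r)`** for any basis `1, θ, θ²` of a `ℚ`-algebra field `L` with
`θ³ + pθ² + qθ + r = 0`: the trace matrix is `(Tr θ^{i+j})` with the power sums `3, −p, p² − 2q, −p³ + 3pq − 3r,
p⁴ − 4p²q + 4pr + 2q²` (Newton), whose determinant is `p²q² − 4q³ − 4p³r − 27r² + 18pqr` (`Cubic.discr`).
[cite: Marcus1977, Ch. 2 (discriminant of a power basis, Exercise 41/Thm. 26)] -/
theorem discr_powers_eq_cubic_discr {p q r : ℚ} [FiniteDimensional ℚ L] (θ : L) (b3 : Module.Basis (Fin 3) ℚ L)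
    (hb : ∀ i, b3 i = θ ^ (i : ℕ)) (hθ : θ ^ 3 + p * θ ^ 2 + q * θ + r = 0) :
    Algebra.discr ℚ ⇑b3 = Cubic.discr ⟨1, p, q, r⟩ := by
  have hM := leftMulMatrix_eq_companion θ b3 hb hθ
  have hfin : Module.finrank ℚ L = 3 := by simpa using Module.finrank_eq_card_basis b3
  have tC : ∀ c : ℚ, Algebra.trace ℚ L (algebraMap ℚ L c) = 3 * c := by
    intro c; rw [Algebra.trace_algebraMap, hfin]; simp
  have t0 : Algebra.trace ℚ L 1 = 3 := by
    rw [show (1 : L) = algebraMap ℚ L 1 from (map_one _).symm, tC]; norm_num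
  have t1 : Algebra.trace ℚ L θ = -p := by
    rw [Algebra.trace_eq_matrix_trace b3, hM]
    simp [Matrix.trace, Fin.sum_univ_three]
  have t2 : Algebra.trace ℚ L (θ ^ 2) = p ^ 2 - 2 * q := by
    rw [Algebra.trace_eq_matrix_trace b3, map_pow, hM]
    simp [Matrix.trace, Fin.sum_univ_three, sq]
    ring
  have hθ3 : θ ^ 3 = -(p • θ ^ 2) - q • θ - algebraMap ℚ L r := by
    simp only [Algebra.smul_def, eq_ratCast]; linear_combination hθ
  have t3 : Algebra.trace ℚ L (θ ^ 3) = -p ^ 3 + 3 * p * q - 3 * r := by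
    rw [hθ3, map_sub, map_sub, map_neg, map_smul, map_smul, t2, t1, tC, smul_eq_mul, smul_eq_mul]; ring
  have hθ4 : θ ^ 4 = -(p • θ ^ 3) - q • θ ^ 2 - r • θ := by
    simp only [Algebra.smul_def, eq_ratCast]; linear_combination θ * hθ
  have t4 : Algebra.trace ℚ L (θ ^ 4) = p ^ 4 - 4 * p ^ 2 * q + 4 * p * r + 2 * q ^ 2 := by
    rw [hθ4, map_sub, map_sub, map_neg, map_smul, map_smul, map_smul, t3, t2, t1, smul_eq_mul, smul_eq_mul,
      smul_eq_mul]; ring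
  have hT : ∀ i j : Fin 3, Algebra.traceMatrix ℚ ⇑b3 i j = Algebra.trace ℚ L (θ ^ ((i : ℕ) + (j : ℕ))) := by
    intro i j; rw [Algebra.traceMatrix_apply, Algebra.traceForm_apply, hb, hb, pow_add]
  have hT' : Algebra.traceMatrix ℚ ⇑b3 = !![3, -p, p ^ 2 - 2 * q; -p, p ^ 2 - 2 * q, -p ^ 3 + 3 * p * q - 3 * r;
      p ^ 2 - 2 * q, -p ^ 3 + 3 * p * q - 3 * r, p ^ 4 - 4 * p ^ 2 * q + 4 * p * r + 2 * q ^ 2] := by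
    ext i j
    fin_cases i <;> fin_cases j <;> rw [hT] <;> simp [t0, t1, t2, t3, t4]
  rw [Algebra.discr_def, hT']
  simp [Matrix.det_fin_three, Cubic.discr]
  ring

end PowerBasisDiscr

/-! ## §2 The index formula (inequality form): `disc = m² · d_K`, `m ≠ 0` -/

section IndexFormula

variable (K : Type) [Field K] [NumberField K]

/-- **`disc(X³ + pX² + qX + r) = m² · d_K` with `m ∈ ℤ ∖ {0}`** for a CUBIC number field `K` containing an algebraic-integer root `b`
of the IRREDUCIBLE cubic: `1, b, b²` is a `ℚ`-basis with discriminant `disc` (§1), it is the image of an integral basis under an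
integer matrix `P` (`b^i ∈ 𝓞 K`), and `discr` transforms with `det(P)²`; `m = det P ≠ 0` since both are bases.
[cite: Marcus1977, Ch. 2 Exercise 27 (disc(α₁..αₙ) = [𝓞:ℤ[α]]² · disc)] -/
theorem exists_sq_mul_discr_eq (h3 : Module.finrank ℚ K = 3) (b : 𝓞 K) {p q r : ℤ}
    (hirr : Irreducible (Cubic.toPoly ⟨1, (p : ℚ), q, r⟩)) (hb : b ^ 3 + p * b ^ 2 + q * b + r = 0) :
    ∃ m : ℤ, m ≠ 0 ∧ m ^ 2 * NumberField.discr K = Cubic.discr ⟨1, p, q, r⟩ := by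
  set θ : K := (b : K) with hθdef
  have hfm : (Cubic.toPoly ⟨1, (p : ℚ), q, r⟩).Monic := Cubic.monic_of_a_eq_one'
  have hθK : θ ^ 3 + (p : K) * θ ^ 2 + (q : K) * θ + (r : K) = 0 := by
    have := congrArg (algebraMap (𝓞 K) K) hb
    simpa [hθdef] using this
  have hθQ : θ ^ 3 + ((p : ℚ) : K) * θ ^ 2 + ((q : ℚ) : K) * θ + ((r : ℚ) : K) = 0 := by
    push_cast; exact hθK
  have hxroot : aeval θ (Cubic.toPoly ⟨1, (p : ℚ), q, r⟩) = 0 := by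
    simp only [Cubic.toPoly, map_one, one_mul, aeval_add, aeval_mul, aeval_C, aeval_X_pow, aeval_X,
      eq_ratCast, Rat.cast_intCast]
    exact hθK
  have hint : IsIntegral ℚ θ := ⟨_, hfm, by rwa [← aeval_def]⟩
  have hmin : minpoly ℚ θ = Cubic.toPoly ⟨1, (p : ℚ), q, r⟩ := (minpoly.eq_of_irreducible_of_monic hirr hxroot hfm).symm
  have hnd : (minpoly ℚ θ).natDegree = 3 := by rw [hmin]; exact Cubic.natDegree_of_a_ne_zero' one_ne_zero
  -- the power basis `1, θ, θ²` indexed by `Fin 3`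
  have hli : LinearIndependent ℚ fun i : Fin 3 => θ ^ (i : ℕ) := by
    have hcomp : (fun i : Fin 3 => θ ^ (i : ℕ)) ∘ (finCongr hnd) =
        fun i : Fin (minpoly ℚ θ).natDegree => θ ^ (i : ℕ) := by
      funext i; simp
    have h0 : LinearIndependent ℚ fun i : Fin (minpoly ℚ θ).natDegree => θ ^ (i : ℕ) := linearIndependent_pow θ
    rw [← hcomp] at h0
    exact (linearIndependent_equiv (finCongr hnd)).mp h0
  let b3 : Module.Basis (Fin 3) ℚ K := basisOfLinearIndependentOfCardEqFinrank hli (by simp [h3])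
  have hb3 : ∀ i, b3 i = θ ^ (i : ℕ) := fun i => by
    simp [b3, coe_basisOfLinearIndependentOfCardEqFinrank]
  have hdisc : Algebra.discr ℚ ⇑b3 = Cubic.discr ⟨1, (p : ℚ), q, r⟩ := discr_powers_eq_cubic_discr θ b3 hb3 hθQ
  -- an integral basis indexed by `Fin 3`
  have hcard : Fintype.card (Module.Free.ChooseBasisIndex ℤ (𝓞 K)) = 3 := by
    rw [← Module.finrank_eq_card_chooseBasisIndex, RingOfIntegers.rank, h3]
  let e : Module.Free.ChooseBasisIndex ℤ (𝓞 K) ≃ Fin 3 := Fintype.equivFinOfCardEq hcard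
  let B3 : Module.Basis (Fin 3) ℤ (𝓞 K) := (RingOfIntegers.basis K).reindex e
  let I3 : Module.Basis (Fin 3) ℚ K := (integralBasis K).reindex e
  have hI3 : ∀ j, I3 j = algebraMap (𝓞 K) K (B3 j) := fun j => by
    simp [I3, B3, integralBasis_apply]
  have hdI : Algebra.discr ℚ ⇑I3 = NumberField.discr K := by
    simp only [I3, Module.Basis.coe_reindex, Algebra.discr_reindex, coe_discr]
  -- the integer change-of-basis matrix and the transformation rule
  let P : Matrix (Fin 3) (Fin 3) ℤ := Matrix.of fun i j => B3.repr (b ^ (i : ℕ)) j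
  have hP : ∀ i j, P i j = B3.repr (b ^ (i : ℕ)) j := fun i j => rfl
  have hvec : ⇑b3 = (P.map (Int.cast : ℤ → ℚ)).map (algebraMap ℚ K) *ᵥ ⇑I3 := by
    funext i
    rw [hb3, Matrix.mulVec, dotProduct]
    have hsum := B3.sum_repr (b ^ (i : ℕ))
    have := congrArg (algebraMap (𝓞 K) K) hsum
    rw [map_sum] at this
    rw [hθdef, ← map_pow, ← this]
    refine Finset.sum_congr rfl fun j _ => ?_
    rw [hI3, Matrix.map_apply, Matrix.map_apply, hP, map_zsmul, zsmul_eq_mul, map_intCast]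
  have key := Algebra.discr_of_matrix_mulVec ⇑I3 (P.map (Int.cast : ℤ → ℚ))
  rw [← hvec, hdisc, hdI] at key
  have hdet : (P.map (Int.cast : ℤ → ℚ)).det = ((P.det : ℤ) : ℚ) := by
    have := RingHom.map_det (Int.castRingHom ℚ) P
    rw [RingHom.mapMatrix_apply, Int.coe_castRingHom] at this
    exact this.symm
  rw [hdet] at key
  have hQ : Cubic.discr ⟨1, (p : ℚ), q, r⟩ = ((Cubic.discr ⟨1, p, q, r⟩ : ℤ) : ℚ) := by
    simp only [Cubic.discr]; push_cast; ring
  refine ⟨P.det, fun h0 => ?_, ?_⟩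
  · -- `det P = 0` would make the discriminant of the basis `1, θ, θ²` vanish
    have hne := Algebra.discr_not_zero_of_basis ℚ b3
    rw [hdisc, key, h0] at hne
    simp at hne
  · rw [hQ] at key
    exact_mod_cast key.symm

/-- **`|d_K| ≤ |disc|`** for a cubic number field containing an algebraic-integer root of the irreducible cubic.
[cite: Marcus1977, Ch. 2 Exercise 27] -/
theorem abs_discr_le_abs_cubic_discr (h3 : Module.finrank ℚ K = 3) (b : 𝓞 K) {p q r : ℤ}
    (hirr : Irreducible (Cubic.toPoly ⟨1, (p : ℚ), q, r⟩)) (hb : b ^ 3 + p * b ^ 2 + q * b + r = 0) :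
    |NumberField.discr K| ≤ |Cubic.discr ⟨1, p, q, r⟩| := by
  obtain ⟨m, hm, hmd⟩ := exists_sq_mul_discr_eq K h3 b hirr hb
  have h1 : 1 ≤ m ^ 2 := by have := sq_pos_of_ne_zero hm; omega
  rw [← hmd, abs_mul, abs_of_nonneg (sq_nonneg m)]
  exact le_mul_of_one_le_left (abs_nonneg _) h1

end IndexFormula

/-! ## §3 Minkowski: `|d_K| ≤ 45` ⟹ class number one (cubic fields) -/

section Minkowski

variable (K : Type) [Field K] [NumberField K]

/-- **A cubic number field with `|d_K| ≤ 45` has class number one**: Minkowski's bound `(2 (π/4)^{r₂} · 3³/3!)²` is `81` (`r₂ = 0`) or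
`(9π/4)² > 45.56` (`r₂ = 1`), so `|d_K| ≤ 45` is below it and every ideal class contains an ideal of norm `1` (Mathlib's
`RingOfIntegers.isPrincipalIdealRing_of_abs_discr_lt`). [cite: Marcus1977, Ch. 5 Cor. 2 of Thm. 37 (Minkowski bound)] -/
theorem classNumber_eq_one_of_abs_discr_le (h3 : Module.finrank ℚ K = 3) (hd : |NumberField.discr K| ≤ 45) :
    NumberField.classNumber K = 1 := by
  rw [NumberField.classNumber_eq_one_iff]
  apply RingOfIntegers.isPrincipalIdealRing_of_abs_discr_lt
  rw [h3]
  have hc : NumberField.InfinitePlace.nrComplexPlaces K ≤ 1 := by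
    have := NumberField.InfinitePlace.card_add_two_mul_card_eq_rank K
    rw [h3] at this
    omega
  have hπ : (3 : ℝ) / 4 < π / 4 := by linarith [Real.pi_gt_three]
  have hpow : (3 : ℝ) / 4 ≤ (π / 4) ^ NumberField.InfinitePlace.nrComplexPlaces K := by
    interval_cases NumberField.InfinitePlace.nrComplexPlaces K
    · norm_num
    · rw [pow_one]; exact hπ.le
  have hd' : ((|NumberField.discr K| : ℤ) : ℝ) ≤ 45 := by exact_mod_cast hd
  calc ((|NumberField.discr K| : ℤ) : ℝ) ≤ 45 := hd'
    _ < (2 * (3 / 4 : ℝ) * ((3 : ℕ) ^ 3 / (3 : ℕ).factorial)) ^ 2 := by norm_num [Nat.factorial]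
    _ ≤ (2 * (π / 4) ^ NumberField.InfinitePlace.nrComplexPlaces K * ((3 : ℕ) ^ 3 / (3 : ℕ).factorial)) ^ 2 := by
        gcongr

/-- **Class number one from a small cubic discriminant**: a CUBIC number field whose integers contain a root of an irreducible
`X³ + pX² + qX + r ∈ ℤ[X]` with `|disc| ≤ 45` has `h_K = 1` (§2 + Minkowski). KERNEL. [cite: Marcus1977, Ch. 5 Cor. 2 of Thm. 37]
[cite: Cohen1993, App. B Table B.4 (the cubic fields of discriminant −23, −31, −44 have h = 1)] -/
theorem classNumber_eq_one_of_cubic_root (h3 : Module.finrank ℚ K = 3) (b : 𝓞 K) {p q r : ℤ}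
    (hirr : Irreducible (Cubic.toPoly ⟨1, (p : ℚ), q, r⟩)) (hb : b ^ 3 + p * b ^ 2 + q * b + r = 0)
    (hsmall : |Cubic.discr ⟨1, p, q, r⟩| ≤ 45) : NumberField.classNumber K = 1 :=
  classNumber_eq_one_of_abs_discr_le K h3 ((abs_discr_le_abs_cubic_discr K h3 b hirr hb).trans hsmall)

end Minkowski

/-! ## §4 The cubic currency `ℚ(β)` -/

section CubicCurrency

variable {p q r : ℤ}

/-- `[ℚ(β) : ℚ] = 3` for a root `β ∈ ℚ̄` of an irreducible monic cubic. [folklore] -/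
theorem finrank_adjoin_eq_three_of_irreducible (hirr : Irreducible (Cubic.toPoly ⟨1, (p : ℚ), q, r⟩))
    {β : AlgebraicClosure ℚ} (hβ : aeval β (Cubic.toPoly ⟨1, (p : ℚ), q, r⟩) = 0) :
    Module.finrank ℚ (IntermediateField.adjoin ℚ {β}) = 3 := by
  have hfm : (Cubic.toPoly ⟨1, (p : ℚ), q, r⟩).Monic := Cubic.monic_of_a_eq_one'
  have hβint : IsIntegral ℚ β := ⟨_, hfm, by rwa [← aeval_def]⟩
  rw [IntermediateField.adjoin.finrank hβint, ← minpoly.eq_of_irreducible_of_monic hirr hβ hfm]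
  exact Cubic.natDegree_of_a_ne_zero' one_ne_zero

/-- **`#Cl(𝓞 ℚ(β)) = 1` for every root `β ∈ ℚ̄` of an irreducible `X³ + pX² + qX + r ∈ ℤ[X]` with `|disc| ≤ 45`** — KERNEL
(§2–§3 for `K = ℚ(β)`, `b = β`). [cite: Marcus1977, Ch. 5 Cor. 2 of Thm. 37] [cite: Cohen1993, App. B Table B.4] -/
theorem card_classGroup_adjoin_eq_one_of_abs_discr_le (hirr : Irreducible (Cubic.toPoly ⟨1, (p : ℚ), q, r⟩))
    (hsmall : |Cubic.discr ⟨1, p, q, r⟩| ≤ 45)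
    {β : AlgebraicClosure ℚ} (hβ : aeval β (Cubic.toPoly ⟨1, (p : ℚ), q, r⟩) = 0) :
    Nat.card (ClassGroup (𝓞 (IntermediateField.adjoin ℚ {β}))) = 1 := by
  have hfm : (Cubic.toPoly ⟨1, (p : ℚ), q, r⟩).Monic := Cubic.monic_of_a_eq_one'
  have hβint : IsIntegral ℚ β := ⟨_, hfm, by rwa [← aeval_def]⟩
  haveI : FiniteDimensional ℚ (IntermediateField.adjoin ℚ {β}) := IntermediateField.adjoin.finiteDimensional hβint
  haveI : NumberField (IntermediateField.adjoin ℚ {β}) := NumberField.mk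
  obtain ⟨b, -, hb⟩ := exists_ringOfIntegers_cubic_root (p := p) (q := q) (r := r) hβ
  have h1 := classNumber_eq_one_of_cubic_root _ (finrank_adjoin_eq_three_of_irreducible hirr hβ) b hirr hb hsmall
  rw [NumberField.classNumber, ← Nat.card_eq_fintype_card] at h1
  exact h1

/-- **The parity bit of the unique-prime door, decided**: `2 ∤ #Cl(𝓞 ℚ(β))` for every root `β` of an irreducible integer cubic
with `|disc| ≤ 45`. KERNEL. [cite: Cohen1993, App. B Table B.4] -/
theorem not_two_dvd_card_classGroup_adjoin_of_abs_discr_le (hirr : Irreducible (Cubic.toPoly ⟨1, (p : ℚ), q, r⟩))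
    (hsmall : |Cubic.discr ⟨1, p, q, r⟩| ≤ 45)
    {β : AlgebraicClosure ℚ} (hβ : aeval β (Cubic.toPoly ⟨1, (p : ℚ), q, r⟩) = 0) :
    ¬ 2 ∣ Nat.card (ClassGroup (𝓞 (IntermediateField.adjoin ℚ {β}))) := by
  rw [card_classGroup_adjoin_eq_one_of_abs_discr_le hirr hsmall hβ]; norm_num

end CubicCurrency

end Summit.BirchSwinnertonDyer.BirchSwinnertonDyer.Theorems.AddKatoTwo

end
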